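import Literature.Geometry.Lorentzian.BogovskiiKernelDeriv
import Mathlib.Analysis.Normed.Module.FiniteDimension
import HarnessLib

/-!
# The ray transforms `Q_m[φ](z; y) = ∫_1^∞ φ(sz + y) s^m ds`: size, vanishing, `z`-derivatives, Lipschitz in `y`

(trunk G08 = T-LORENTZ; family `gr`; namespace `Literature.Geometry.Lorentzian.MaoOhTao`.)

Mao–Oh–Tao (arXiv:2308.13031), Lemma 2.3: the classical kernel of the Bogovskiĭ-type operator `S_η` is
`Ψ_y(z) = zᵢzⱼ Q_2[η](z; y)` with `Q_m[φ](z; y) = ∫_1^∞ φ(sz + y) s^m ds` (`BogovskiiClassicalForm`,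
`BogovskiiKernelDeriv`).  All `z`-derivatives of `Ψ` are polynomials in `z` and ray transforms of derivatives of `η`,
because of the basic rule

  `∂_{z,v} Q_m[φ] = Q_{m+1}[∂_v φ]`  (`fderiv_bogovskiiQ_apply`),

proved by differentiation under the integral sign off `z = 0` (`hasFDerivAt_bogovskiiQ`, the general-`m` version of
`hasFDerivAt_Q`).  Also: the size bound `|Q_m[φ](z; y)| ≤ 2 sup|φ| T^{m+1}`, `T = (R + |y|)₊/|z|`
(`abs_bogovskiiQ_le`, so `Q_m ≲ |z|^{−m−1}`), vanishing for `|z| > (R + |y|)₊` (`bogovskiiQ_eq_zero_of_lt`),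
continuity and continuity of the derivative off the origin (`continuousOn_bogovskiiQ`, `continuousOn_fderiv_bogovskiiQ`),
and the Lipschitz bound in the base point `|Q_m[φ](z; y₁) − Q_m[φ](z; y₂)| ≤ 2 sup‖Dφ‖ |y₁ − y₂| T_ρ^{m+1}`
(`abs_bogovskiiQ_sub_le`).  These are the inputs for the second-derivative (Calderón–Zygmund) kernel of `S_η`.

## References

* Y. Mao, S.-J. Oh, T. Tao, arXiv:2308.13031 (2023), Lemma 2.3, pp. 8–9 (key `MaoOhTao2023`).
-/

noncomputable section

open scoped RealInnerProductSpace Topology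
open Filter MeasureTheory Set Metric Function

namespace Literature.Geometry.Lorentzian

namespace MaoOhTao

variable {φ : E3 → ℝ} {R : ℝ}

/-- The **ray transform** `Q_m[φ](z; y) = ∫_1^∞ φ(sz + y) s^m ds` (for `m = 2` this is the factor `Q_y(z)` of the
classical Bogovskiĭ kernel `zᵢzⱼQ_y(z)`, `bogovskiiKernel_eq_classical`). [cite: MaoOhTao2023, Lemma 2.3] -/
def bogovskiiQ (φ : E3 → ℝ) (y : E3) (m : ℕ) (z : E3) : ℝ := ∫ s in Ioi (1 : ℝ), φ (s • z + y) * s ^ m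

/-- Unfolding lemma. [cite: MaoOhTao2023, Lemma 2.3] -/
theorem bogovskiiQ_apply (φ : E3 → ℝ) (y : E3) (m : ℕ) (z : E3) :
    bogovskiiQ φ y m z = ∫ s in Ioi (1 : ℝ), φ (s • z + y) * s ^ m := rfl

/-- **Size**: `|Q_m[φ](z; y)| ≤ 2 T (sup|φ| T^m)`, `T = (R + |y|)₊/|z|`, `z ≠ 0`. [folklore] -/
theorem abs_bogovskiiQ_le (hφ : Continuous φ) (hR : ∀ z : E3, R < ‖z‖ → φ z = 0) {M : ℝ} (hM : ∀ w, |φ w| ≤ M)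
    (y : E3) (m : ℕ) {z : E3} (hz : z ≠ 0) :
    |bogovskiiQ φ y m z| ≤ 2 * (max (R + ‖y‖) 0 / ‖z‖) * (M * (max (R + ‖y‖) 0 / ‖z‖) ^ m) := by
  have hn : 0 < ‖z‖ := norm_pos_iff.2 hz
  have hM0 : 0 ≤ M := (abs_nonneg _).trans (hM 0)
  set T : ℝ := max (R + ‖y‖) 0 / ‖z‖ with hT
  have hT0 : 0 ≤ T := div_nonneg (le_max_right _ _) hn.le
  rw [bogovskiiQ_apply, ← Real.norm_eq_abs]
  have hg : Continuous fun s : ℝ ↦ φ (s • z + y) * s ^ m :=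
    (hφ.comp ((continuous_id.smul continuous_const).add continuous_const)).mul (continuous_pow m)
  refine norm_setIntegral_Ioi_le_of_bound (g := fun s : ℝ ↦ φ (s • z + y) * s ^ m) hg hT0 (fun s hs ↦ ?_)
    (fun s ↦ ?_) 1
  · show φ (s • z + y) * s ^ m = 0
    rw [eta_ray_eq_zero hR (lt_abs_mul_norm_of_lt hz hs), zero_mul]
  · show ‖φ (s • z + y) * s ^ m‖ ≤ M * T ^ m
    by_cases hs : |s| ≤ T
    · rw [norm_mul, Real.norm_eq_abs, Real.norm_eq_abs, abs_pow]
      exact mul_le_mul (hM _) (pow_le_pow_left₀ (abs_nonneg s) hs m) (by positivity) hM0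
    · rw [eta_ray_eq_zero hR (lt_abs_mul_norm_of_lt hz (not_le.1 hs)), zero_mul, norm_zero]
      positivity

/-- **Vanishing**: `Q_m[φ](z; y) = 0` for `|z| > (R + |y|)₊`. [folklore] -/
theorem bogovskiiQ_eq_zero_of_lt (hR : ∀ z : E3, R < ‖z‖ → φ z = 0) (y : E3) (m : ℕ) {z : E3}
    (hz : max (R + ‖y‖) 0 < ‖z‖) : bogovskiiQ φ y m z = 0 := by
  rw [bogovskiiQ_apply]
  refine setIntegral_eq_zero_of_forall_eq_zero fun s hs ↦ ?_
  have hs1 : 1 ≤ |s| := (le_of_lt hs).trans (le_abs_self s)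
  rw [eta_ray_eq_zero hR ?_, zero_mul]
  calc R + ‖y‖ ≤ max (R + ‖y‖) 0 := le_max_left _ _
    _ < ‖z‖ := hz
    _ ≤ |s| * ‖z‖ := le_mul_of_one_le_left (norm_nonneg _) hs1

/-- The `s`-integrand of the derivative, `s ↦ s^{m+1} • Dφ(sz + y)`, is integrable on `(1, ∞)` (compact support in `s`
for `z ≠ 0`). [folklore] -/
theorem integrable_pow_smul_fderiv_ray (hφ : ContDiff ℝ 1 φ) (hR : ∀ z : E3, R < ‖z‖ → φ z = 0) (y : E3) (m : ℕ)
    {z : E3} (hz : z ≠ 0) :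
    Integrable (fun s : ℝ ↦ (s ^ (m + 1)) • fderiv ℝ φ (s • z + y)) (volume.restrict (Ioi 1)) := by
  have hdc : Continuous (fderiv ℝ φ) := hφ.continuous_fderiv one_ne_zero
  set T : ℝ := max (R + ‖y‖) 0 / ‖z‖
  have hc : Continuous fun s : ℝ ↦ (s ^ (m + 1)) • fderiv ℝ φ (s • z + y) :=
    (continuous_pow (m + 1)).smul (hdc.comp ((continuous_id.smul continuous_const).add continuous_const))
  refine (hc.integrable_of_hasCompactSupport (HasCompactSupport.intro (isCompact_Icc (a := -T) (b := T))
    fun s hs ↦ ?_)).restrict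
  have hs' : T < |s| := by
    by_contra hle
    exact hs (abs_le.1 (not_lt.1 hle))
  show (s ^ (m + 1)) • fderiv ℝ φ (s • z + y) = 0
  rw [fderiv_eta_ray_eq_zero hR (lt_abs_mul_norm_of_lt hz hs'), smul_zero]

/-- **`Q_m[φ]` is differentiable in `z ≠ 0`, with derivative under the integral sign**:
`D_z Q_m[φ](z₀; y) = ∫_1^∞ s^{m+1} Dφ(sz₀ + y) ds` for `φ ∈ C¹` vanishing off `B̄_R`. [folklore] -/
theorem hasFDerivAt_bogovskiiQ (hφ : ContDiff ℝ 1 φ) (hR : ∀ z : E3, R < ‖z‖ → φ z = 0) (y : E3) (m : ℕ) {z₀ : E3}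
    (hz₀ : z₀ ≠ 0) :
    HasFDerivAt (bogovskiiQ φ y m) (∫ s in Ioi (1 : ℝ), (s ^ (m + 1)) • fderiv ℝ φ (s • z₀ + y)) z₀ := by
  have hφc : Continuous φ := hφ.continuous
  have hdc : Continuous (fderiv ℝ φ) := hφ.continuous_fderiv one_ne_zero
  obtain ⟨M', hM'⟩ := hdc.bounded_above_of_compact_support ((HasCompactSupport.intro (isCompact_closedBall (0 : E3) R)
    fun z hz ↦ hR z (by rwa [mem_closedBall, dist_zero_right, not_le] at hz)).fderiv (𝕜 := ℝ))
  have hM'0 : 0 ≤ M' := (norm_nonneg _).trans (hM' 0)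
  have hn₀ : 0 < ‖z₀‖ := norm_pos_iff.2 hz₀
  set S₀ : ℝ := max (R + ‖y‖) 0 / (‖z₀‖ / 2) with hS₀
  have hS₀0 : 0 ≤ S₀ := div_nonneg (le_max_right _ _) (by positivity)
  have hzlow : ∀ z ∈ ball z₀ (‖z₀‖ / 2), ‖z₀‖ / 2 ≤ ‖z‖ := by
    intro z hz
    rw [mem_ball, dist_eq_norm] at hz
    have := norm_sub_norm_le z₀ z
    rw [← norm_neg, neg_sub] at hz
    linarith
  have hvan : ∀ z ∈ ball z₀ (‖z₀‖ / 2), ∀ s : ℝ, S₀ < |s| → R + ‖y‖ < |s| * ‖z‖ := by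
    intro z hz s hs
    have h1 := hzlow z hz
    rw [hS₀, div_lt_iff₀ (by positivity)] at hs
    calc R + ‖y‖ ≤ max (R + ‖y‖) 0 := le_max_left _ _
      _ < |s| * (‖z₀‖ / 2) := hs
      _ ≤ |s| * ‖z‖ := mul_le_mul_of_nonneg_left h1 (abs_nonneg s)
  set F : E3 → ℝ → ℝ := fun z s ↦ φ (s • z + y) * s ^ m with hF
  set F' : E3 → ℝ → (E3 →L[ℝ] ℝ) := fun z s ↦ (s ^ (m + 1)) • fderiv ℝ φ (s • z + y) with hF'
  have hFc : ∀ z, Continuous (F z) := fun z ↦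
    (hφc.comp ((continuous_id.smul continuous_const).add continuous_const)).mul (continuous_pow m)
  have hF'c : ∀ z, Continuous (F' z) := fun z ↦
    (continuous_pow (m + 1)).smul (hdc.comp ((continuous_id.smul continuous_const).add continuous_const))
  have hF_meas : ∀ᶠ z in 𝓝 z₀, AEStronglyMeasurable (F z) (volume.restrict (Ioi 1)) :=
    Eventually.of_forall fun z ↦ (hFc z).aestronglyMeasurable
  have hF_int : Integrable (F z₀) (volume.restrict (Ioi 1)) := by
    refine ((hFc z₀).integrable_of_hasCompactSupport (HasCompactSupport.intro (isCompact_Icc (a := -S₀) (b := S₀))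
      fun s hs ↦ ?_)).restrict
    have hs' : S₀ < |s| := by
      by_contra hle
      exact hs (abs_le.1 (not_lt.1 hle))
    show φ (s • z₀ + y) * s ^ m = 0
    rw [eta_ray_eq_zero hR (hvan z₀ (mem_ball_self (by positivity)) s hs'), zero_mul]
  have hF'_meas : AEStronglyMeasurable (F' z₀) (volume.restrict (Ioi 1)) := (hF'c z₀).aestronglyMeasurable
  have h_bound : ∀ᵐ s ∂(volume.restrict (Ioi 1)), ∀ z ∈ ball z₀ (‖z₀‖ / 2), ‖F' z s‖ ≤
      (Icc (-S₀) S₀).indicator (fun _ ↦ M' * S₀ ^ (m + 1)) s := by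
    refine ae_of_all _ fun s z hz ↦ ?_
    by_cases hs : s ∈ Icc (-S₀) S₀
    · rw [indicator_of_mem hs, hF', norm_smul, Real.norm_eq_abs, abs_pow, mul_comm]
      exact mul_le_mul (hM' _) (pow_le_pow_left₀ (abs_nonneg s) (abs_le.2 ⟨hs.1, hs.2⟩) (m + 1)) (by positivity)
        hM'0
    · rw [indicator_of_notMem hs]
      have hs' : S₀ < |s| := by
        by_contra hle
        exact hs (abs_le.1 (not_lt.1 hle))
      simp only [hF']
      rw [fderiv_eta_ray_eq_zero hR (hvan z hz s hs'), smul_zero, norm_zero]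
  have hbi : Integrable (fun s : ℝ ↦ (Icc (-S₀) S₀).indicator (fun _ ↦ M' * S₀ ^ (m + 1)) s)
      (volume.restrict (Ioi 1)) :=
    ((integrable_indicator_iff measurableSet_Icc).2 continuous_const.integrableOn_Icc).restrict
  have h_diff : ∀ᵐ s ∂(volume.restrict (Ioi 1)), ∀ z ∈ ball z₀ (‖z₀‖ / 2), HasFDerivAt (F · s) (F' z s) z := by
    refine ae_of_all _ fun s z _ ↦ ?_
    have h1 : HasFDerivAt (fun z : E3 ↦ s • z + y) (s • ContinuousLinearMap.id ℝ E3) z :=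
      ((hasFDerivAt_id z).const_smul s).add_const y
    have h2 : HasFDerivAt φ (fderiv ℝ φ (s • z + y)) (s • z + y) := (hφ.differentiable one_ne_zero _).hasFDerivAt
    have h3 := (h2.comp z h1).mul_const (s ^ m)
    have heq : (s ^ m) • (fderiv ℝ φ (s • z + y)).comp (s • ContinuousLinearMap.id ℝ E3) = F' z s := by
      ext v
      simp [hF', pow_succ]
      ring
    rw [← heq]
    simpa only [Function.comp_def] using h3
  have h := hasFDerivAt_integral_of_dominated_of_fderiv_le (ball_mem_nhds z₀ (by positivity)) hF_meas hF_int hF'_meas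
    h_bound hbi h_diff
  exact h

/-- **The basic rule `∂_{z,v} Q_m[φ] = Q_{m+1}[∂_v φ]`** off `z = 0`, for `φ ∈ C¹` vanishing off `B̄_R`. [folklore] -/
theorem fderiv_bogovskiiQ_apply (hφ : ContDiff ℝ 1 φ) (hR : ∀ z : E3, R < ‖z‖ → φ z = 0) (y : E3) (m : ℕ) {z : E3}
    (hz : z ≠ 0) (v : E3) :
    fderiv ℝ (bogovskiiQ φ y m) z v = bogovskiiQ (fun w ↦ fderiv ℝ φ w v) y (m + 1) z := by
  rw [(hasFDerivAt_bogovskiiQ hφ hR y m hz).fderiv, bogovskiiQ_apply,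
    ContinuousLinearMap.integral_apply (integrable_pow_smul_fderiv_ray hφ hR y m hz) v]
  congr 1; funext s
  simp only [FunLike.coe_smul, Pi.smul_apply, smul_eq_mul]
  ring

/-- Differentiability of `Q_m[φ]` off the origin. [folklore] -/
theorem differentiableAt_bogovskiiQ (hφ : ContDiff ℝ 1 φ) (hR : ∀ z : E3, R < ‖z‖ → φ z = 0) (y : E3) (m : ℕ)
    {z : E3} (hz : z ≠ 0) : DifferentiableAt ℝ (bogovskiiQ φ y m) z :=
  (hasFDerivAt_bogovskiiQ hφ hR y m hz).differentiableAt

/-- Continuity of `Q_m[φ]` off the origin. [folklore] -/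
theorem continuousOn_bogovskiiQ (hφ : ContDiff ℝ 1 φ) (hR : ∀ z : E3, R < ‖z‖ → φ z = 0) (y : E3) (m : ℕ) :
    ContinuousOn (bogovskiiQ φ y m) {0}ᶜ := fun _ hz ↦
  (differentiableAt_bogovskiiQ hφ hR y m hz).continuousAt.continuousWithinAt

/-- A partial derivative of a `C^{k+1}` function vanishing off `B̄_R` is `C^k` and vanishes off `B̄_R`. [folklore] -/
theorem contDiff_fderiv_apply_of_vanish {k : ℕ} (hφ : ContDiff ℝ (k + 1) φ) (hR : ∀ z : E3, R < ‖z‖ → φ z = 0)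
    (v : E3) : ContDiff ℝ k (fun w ↦ fderiv ℝ φ w v) ∧ ∀ z : E3, R < ‖z‖ → fderiv ℝ φ z v = 0 := by
  refine ⟨(ContinuousLinearMap.apply ℝ ℝ v).contDiff.comp (hφ.fderiv_right (m := k) (by norm_cast)), fun z hz ↦ ?_⟩
  have hev : φ =ᶠ[𝓝 z] fun _ ↦ 0 := by
    filter_upwards [(isOpen_lt continuous_const continuous_norm).mem_nhds hz] with w hw
    exact hR w hw
  rw [hev.fderiv_eq, fderiv_fun_const, Pi.zero_apply]; rfl

/-- **Continuity of the derivative of `Q_m[φ]` off the origin** for `φ ∈ C²` (each directional derivative is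
`Q_{m+1}[∂_vφ]`, continuous off `0`; finite dimension). [folklore] -/
theorem continuousOn_fderiv_bogovskiiQ (hφ : ContDiff ℝ 2 φ) (hR : ∀ z : E3, R < ‖z‖ → φ z = 0) (y : E3) (m : ℕ) :
    ContinuousOn (fun z ↦ fderiv ℝ (bogovskiiQ φ y m) z) {0}ᶜ := by
  rw [continuousOn_clm_apply]
  intro v
  obtain ⟨hφv, hRv⟩ := contDiff_fderiv_apply_of_vanish (k := 1) hφ hR v
  have h1 : ContDiff ℝ 1 φ := hφ.of_le (by norm_cast)
  refine (continuousOn_bogovskiiQ hφv hRv y (m + 1)).congr fun z hz ↦ ?_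
  exact fderiv_bogovskiiQ_apply h1 hR y m hz v

/-- **Lipschitz bound in the base point**: for `|y₁|, |y₂| ≤ ρ`, `z ≠ 0` and `‖Dφ‖ ≤ M'`,
`|Q_m[φ](z; y₁) − Q_m[φ](z; y₂)| ≤ 2 T_ρ (M' |y₁ − y₂| T_ρ^m)`, `T_ρ = (R + ρ)₊/|z|`. [folklore] -/
theorem abs_bogovskiiQ_sub_le (hφ : ContDiff ℝ 1 φ) (hR : ∀ z : E3, R < ‖z‖ → φ z = 0) {M' : ℝ}
    (hM' : ∀ w, ‖fderiv ℝ φ w‖ ≤ M') {ρ : ℝ} {y₁ y₂ : E3} (hy₁ : ‖y₁‖ ≤ ρ) (hy₂ : ‖y₂‖ ≤ ρ) (m : ℕ) {z : E3}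
    (hz : z ≠ 0) :
    |bogovskiiQ φ y₁ m z - bogovskiiQ φ y₂ m z| ≤
      2 * (max (R + ρ) 0 / ‖z‖) * (M' * ‖y₁ - y₂‖ * (max (R + ρ) 0 / ‖z‖) ^ m) := by
  have hn : 0 < ‖z‖ := norm_pos_iff.2 hz
  have hM'0 : 0 ≤ M' := (norm_nonneg _).trans (hM' 0)
  have hφc : Continuous φ := hφ.continuous
  set T : ℝ := max (R + ρ) 0 / ‖z‖ with hT
  have hT0 : 0 ≤ T := div_nonneg (le_max_right _ _) hn.le
  -- beyond `T` both integrands vanish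
  have hvan : ∀ (y : E3), ‖y‖ ≤ ρ → ∀ s : ℝ, T < |s| → φ (s • z + y) = 0 := by
    intro y hy s hs
    apply eta_ray_eq_zero hR
    rw [hT, div_lt_iff₀ hn] at hs
    calc R + ‖y‖ ≤ R + ρ := by linarith
      _ ≤ max (R + ρ) 0 := le_max_left _ _
      _ < |s| * ‖z‖ := hs
  have hg1 : Continuous fun s : ℝ ↦ φ (s • z + y₁) * s ^ m :=
    (hφc.comp ((continuous_id.smul continuous_const).add continuous_const)).mul (continuous_pow m)
  have hg2 : Continuous fun s : ℝ ↦ φ (s • z + y₂) * s ^ m :=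
    (hφc.comp ((continuous_id.smul continuous_const).add continuous_const)).mul (continuous_pow m)
  have hi : ∀ (y : E3), ‖y‖ ≤ ρ → Integrable (fun s : ℝ ↦ φ (s • z + y) * s ^ m) (volume.restrict (Ioi 1)) := by
    intro y hy
    have hc : Continuous fun s : ℝ ↦ φ (s • z + y) * s ^ m :=
      (hφc.comp ((continuous_id.smul continuous_const).add continuous_const)).mul (continuous_pow m)
    refine (hc.integrable_of_hasCompactSupport (HasCompactSupport.intro (isCompact_Icc (a := -T) (b := T))
      fun s hs ↦ ?_)).restrict
    have hs' : T < |s| := by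
      by_contra hle
      exact hs (abs_le.1 (not_lt.1 hle))
    show φ (s • z + y) * s ^ m = 0
    rw [hvan y hy s hs', zero_mul]
  rw [bogovskiiQ_apply, bogovskiiQ_apply, ← integral_sub (hi y₁ hy₁) (hi y₂ hy₂), ← Real.norm_eq_abs]
  have hlip : ∀ a b : E3, |φ a - φ b| ≤ M' * ‖a - b‖ := by
    intro a b
    rw [← Real.norm_eq_abs]
    exact (convex_univ).norm_image_sub_le_of_norm_fderiv_le (fun w _ ↦ hφ.differentiable one_ne_zero w)
      (fun w _ ↦ hM' w) (mem_univ b) (mem_univ a)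
  refine norm_setIntegral_Ioi_le_of_bound (g := fun s : ℝ ↦ φ (s • z + y₁) * s ^ m - φ (s • z + y₂) * s ^ m)
    (hg1.sub hg2) hT0 (fun s hs ↦ ?_) (fun s ↦ ?_) 1
  · show φ (s • z + y₁) * s ^ m - φ (s • z + y₂) * s ^ m = 0
    rw [hvan y₁ hy₁ s hs, hvan y₂ hy₂ s hs]; ring
  · show ‖φ (s • z + y₁) * s ^ m - φ (s • z + y₂) * s ^ m‖ ≤ M' * ‖y₁ - y₂‖ * T ^ m
    by_cases hs : |s| ≤ T
    · rw [← sub_mul, norm_mul, Real.norm_eq_abs, Real.norm_eq_abs, abs_pow]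
      refine mul_le_mul ((hlip _ _).trans (le_of_eq ?_)) (pow_le_pow_left₀ (abs_nonneg s) hs m) (by positivity)
        (by positivity)
      rw [add_sub_add_left_eq_sub]
    · rw [hvan y₁ hy₁ s (not_le.1 hs), hvan y₂ hy₂ s (not_le.1 hs)]
      simp only [zero_mul, sub_self, norm_zero]
      positivity

end MaoOhTao

end Literature.Geometry.Lorentzian

end
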